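import Summits.CriticalPhenomena.PercolationContinuityZ3.Theorems.PercNearOneGluingNoHeavyLowerTailSahiThreeCopyOrEvents

/-!
# `NoHeavyLowerTail` (crux stmt-CriticalPhenomena-4575), Sahi programme: **3C-SAHI IS STABLE UNDER ADJOINING FRESH LITERALS** —
# if `(f,g,h)` satisfies the three-copy Sahi inequality at every profile, then so do `(f ∨ x₀^{c₁}, g ∨ x₀^{c₂}, h ∨ x₀^{c₃})` and
# `(f ∧ x₀^{c₁}, g ∧ x₀^{c₂}, h ∧ x₀^{c₃})` for a fresh coordinate `x₀` (each slot independently adjoined or not)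

Support file (Sahi cell, seat `prim-sahi-p1`, generation 54; `--supports stmt-CriticalPhenomena-4575`); companion of `…SahiThreeCopyOrEvents`.
Pure proofs plus bookkeeping definitions (`nb`, `orAdj`, `ua`, `ub`, `andAdj`); no `sorry`, standard axioms.

THE THEOREMS.  For `f, g, h : {0,1}^d → [0,1]` monotone with `0 ≤ c_b(f,g,h)` for every profile `b` (the census conjecture 3C-SAHI, CENSUS §175,
for this triple) and bits `c₁, c₂, c₃`:
* ★★ `tc_orAdj_cons_nonneg` (OR-LITERAL STEP): with `(f ∨_c x₀)(ε,x) = 1` if `c ∧ ε = 1`, else `f(x)` (`orAdj`): `0 ≤ c_{(k,b)}(f ∨_{c₁} x₀, g ∨_{c₂} x₀, h ∨_{c₃} x₀)`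
  for every `k`.  (Iterated in the companion file `…SahiThreeCopyLiteralsIter`: OR-ing each of the three events with an arbitrary OR-event on fresh
  coordinates preserves 3C-SAHI at every profile; with the settled classes of `…Cylinder` / `…Nested` this gives new settled classes, e.g.
  `(1_{↑m} ∨ OR_S, 1_B ∨ OR_T, 1_C ∨ OR_U)` for arbitrary up-sets `B, C`; with the trivial triple it is `…OrEvents.tc_orInd_nonneg` again.)
* ★ `tc_andAdj_cons_nonneg` (AND-LITERAL STEP): with `(f ∧_c x₀)(ε,x) = 0` if `c ∧ ε = 0`, else `f(x)` (`andAdj`): `0 ≤ c_{(k,b)}(f ∧_{c₁} x₀, …)`.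
So the class of triples satisfying 3C-SAHI at every profile is closed under building the three events by a common "caterpillar" read-once formula
in fresh literals (each gate adjoins one literal by `∨` or `∧` to each of the three events, or skips it).

THE MECHANISM (memo FROM-prim-sahi-p1-gen54 §3).  Along the fresh coordinate the sections of the complements `1 − (f ∨_c x₀)` (resp. of `f ∧_c x₀`)
are SCALAR multiples `(1 + β·ε)·(1 − f)` (resp. `(α + β·ε)·f`) of one function, so every three-copy functional FACTORISES over the new coordinate
(`N3_cons_of_sec`, `N3_cons_form`: factor `C(3,k)·φ_r(k)` of `…OrEvents`, `r` = number of copies requiring the literal).  The OR step is then, via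
the complement identity `tc_compl`, the inequality `Φ(ℓ ⊙ W) ≥ 0` for the leaf vector `ℓ` and the eleven-vector `W` of the inner complement triple; in
each of the 32 cases `(c₁,c₂,c₃,k)` it is an explicit nonnegative combination (found by LP, checked here by `linarith`) of: `Φ(W) = c_b(f,g,h) ≥ 0`
(hypothesis), the three Harris gaps `H(f,g), H(f,h), H(g,h) ≥ 0`, the three "union" Harris gaps `H(f,gh), H(g,fh), H(h,fg) ≥ 0` (three-copy Harris,
`N3_le_N3_mul`) — all rewritten in complement coordinates by `harris_compl` / `unionHarris_compl` — and monotonicity `N(ūv̄) ≥ N(ūv̄w̄) ≥ 0`.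
The AND step is the analogous 5-term statement with the Harris chain `N(fgh) ≥ N(f;gh)`.  (General block version — closure of 3C-SAHI under
block-OR / block-AND of two arbitrary triples — holds by the same algebra plus a transport lemma; memo §3, not typed here.)
[this work; conjecture: CENSUS §175 W197 (prim-sahi-census gen 54)]
-/

namespace Summit.CriticalPhenomena.PercolationContinuityZ3.Theorems.SahiThreeCopy

open Finset Function Literature.Combinatorics.Sahi2008
open scoped BigOperators

noncomputable section

variable {d : ℕ}

/-! ### §1 One-coordinate factorisation for functions with scalar sections -/

/-- If the sections of `F, G, H` along coordinate `0` are the scalar multiples `(α + β·ε)·f`, `(α' + β'·ε)·g`, `(α'' + β''·ε)·h`, then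
`N_{(k,b)}(F;G;H) = L_k(α,β,α',β',α'',β'')·N_b(f;g;h)` (`locN3` of `…Products`). [this work] -/
theorem N3_cons_of_sec (k : ℕ) (b : Fin d → ℕ) {F G H : Pt (d + 1) → ℝ} {f g h : Pt d → ℝ} {α β α' β' α'' β'' : ℝ}
    (hF : ∀ ε, sec F ε = (α + if ε then β else 0) • f) (hG : ∀ ε, sec G ε = (α' + if ε then β' else 0) • g)
    (hH : ∀ ε, sec H ε = (α'' + if ε then β'' else 0) • h) :
    N3 (Fin.cons k b : Fin (d + 1) → ℕ) F G H = locN3 k α β α' β' α'' β'' * N3 b f g h := by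
  rw [N3_cons]
  simp only [hF, hG, hH, N3_smul_left, N3_smul_mid, N3_smul_right]
  unfold locN3
  rw [sum_mul]; refine sum_congr rfl fun ε₁ _ => ?_
  rw [sum_mul]; refine sum_congr rfl fun ε₂ _ => ?_
  rw [sum_mul]; refine sum_congr rfl fun ε₃ _ => ?_
  split_ifs <;> ring

/-- The coefficient `β` of a literal: `−1` if adjoined, `0` if not. [this work] -/
def nb (c : Bool) : ℝ := if c then -1 else 0

/-- Products of two complement-literal scalars: `(1 + β_{c₁}ε)(1 + β_{c₂}ε) = 1 + β_{c₁ ∨ c₂}ε`. [this work] -/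
theorem nb_form_mul (c₁ c₂ ε : Bool) :
    (1 + (if ε then nb c₁ else 0)) * (1 + if ε then nb c₂ else 0) = 1 + if ε then nb (c₁ || c₂) else 0 := by
  cases c₁ <;> cases c₂ <;> cases ε <;> norm_num [nb]

/-- Sections of a product of two functions with complement-literal scalar sections. [this work] -/
theorem sec_mul_form {U V : Pt (d + 1) → ℝ} {u v : Pt d → ℝ} {c₁ c₂ : Bool}
    (hU : ∀ ε, sec U ε = (1 + if ε then nb c₁ else 0) • u) (hV : ∀ ε, sec V ε = (1 + if ε then nb c₂ else 0) • v) :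
    ∀ ε, sec (U * V) ε = (1 + if ε then nb (c₁ || c₂) else 0) • (u * v) := by
  intro ε
  rw [sec_mul, hU, hV, ← nb_form_mul]
  funext x
  simp only [Pi.mul_apply, Pi.smul_apply, smul_eq_mul]
  ring

/-- The constant `1` has the trivial scalar sections (`c = false`). [this work] -/
theorem sec_one_form : ∀ ε : Bool, sec (1 : Pt (d + 1) → ℝ) ε = (1 + if ε then nb false else 0) • (1 : Pt d → ℝ) := by
  intro ε; funext x; simp [sec, nb]

/-- ★ `N_{(k,b)}` of three functions with complement-literal sections `(1 + β_{c_j}ε)·u_j` is `C(3,k)·φ_r(k)·N_b(u₁;u₂;u₃)`, `r = c₁ + c₂ + c₃`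
(`locN3_one_neg` of `…OrEvents`). [this work] -/
theorem N3_cons_form (k : ℕ) (b : Fin d → ℕ) {U V W : Pt (d + 1) → ℝ} {u v w : Pt d → ℝ} {c₁ c₂ c₃ : Bool}
    (hU : ∀ ε, sec U ε = (1 + if ε then nb c₁ else 0) • u) (hV : ∀ ε, sec V ε = (1 + if ε then nb c₂ else 0) • v)
    (hW : ∀ ε, sec W ε = (1 + if ε then nb c₃ else 0) • w) :
    N3 (Fin.cons k b : Fin (d + 1) → ℕ) U V W = (Nat.choose 3 k : ℝ) * phi (c₁.toNat + c₂.toNat + c₃.toNat) k * N3 b u v w := by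
  rw [N3_cons_of_sec k b hU hV hW]
  unfold nb
  rw [locN3_one_neg]

/-! ### §2 Harris gaps in complement coordinates -/

/-- The three-copy Harris gap is complement-invariant: `N_b(ūv̄;1;1) − N_b(ū;v̄;1) = N_b(fg;1;1) − N_b(f;g;1)` for `ū = 1−f`, `v̄ = 1−g`. [this work] -/
theorem harris_compl (b : Fin d → ℕ) (f g : Pt d → ℝ) :
    N3 b ((1 - f) * (1 - g)) 1 1 - N3 b (1 - f) (1 - g) 1 = N3 b (f * g) 1 1 - N3 b f g 1 := by
  have e : (1 - f) * (1 - g) = 1 - f - g + f * g := by ring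
  rw [e, N3_add_left, N3_sub_left, N3_sub_left, N3_sub_left, N3_sub_mid, N3_sub_mid, N3_comm12 b 1 g 1, N3_comm12 b f 1 1]
  ring

/-- The "union" Harris gap in complement coordinates: with `ū = 1−f`, `v̄ = 1−g`, `w̄ = 1−h`,
`H_b(ū,v̄) + H_b(ū,w̄) − N_b(ūv̄w̄;1;1) + N_b(ū;v̄w̄;1) = N_b(f·gh;1;1) − N_b(f;gh;1)` (the Harris gap of `f` and `gh`). [this work] -/
theorem unionHarris_compl (b : Fin d → ℕ) (f g h : Pt d → ℝ) :
    (N3 b ((1 - f) * (1 - g)) 1 1 - N3 b (1 - f) (1 - g) 1) + (N3 b ((1 - f) * (1 - h)) 1 1 - N3 b (1 - f) (1 - h) 1) -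
      N3 b ((1 - f) * (1 - g) * (1 - h)) 1 1 + N3 b (1 - f) ((1 - g) * (1 - h)) 1 = N3 b (f * (g * h)) 1 1 - N3 b f (g * h) 1 := by
  rw [harris_compl, harris_compl]
  have e1 : (1 - f) * (1 - g) * (1 - h) = 1 - f - g - h + f * g + f * h + g * h - f * (g * h) := by ring
  have e2 : (1 - g) * (1 - h) = 1 - g - h + g * h := by ring
  rw [e1, e2]
  simp only [N3_add_left, N3_sub_left, N3_add_mid, N3_sub_mid]
  rw [N3_comm12 b 1 g 1, N3_comm12 b 1 h 1, N3_comm12 b 1 (g * h) 1, N3_comm12 b f 1 1]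
  ring

/-! ### §3 Adjoining an OR-literal -/

/-- ADJOIN THE FRESH COORDINATE `0` AS AN OR-LITERAL (if `c`): `(f ∨_c x₀)(x) = 1` if `c` and `x₀ = 1`, else `f(x₁,…,x_d)`. [this work] -/
def orAdj (c : Bool) (f : Pt d → ℝ) : Pt (d + 1) → ℝ := fun x => if c = true ∧ x 0 = true then 1 else f (Fin.tail x)

/-- Sections of the complement of an OR-adjoined function: `(1 − f ∨_c x₀)^ε = (1 + β_c ε)·(1 − f)`. [this work] -/
theorem sec_compl_orAdj (c : Bool) (f : Pt d → ℝ) :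
    ∀ ε : Bool, sec (1 - orAdj c f) ε = (1 + if ε then nb c else 0) • (1 - f) := by
  intro ε; funext x
  cases c <;> cases ε <;> simp [sec, orAdj, nb, Fin.tail_cons, Fin.cons_zero]

/-- `f ∨_c x₀` is nonnegative. [this work] -/
theorem orAdj_nonneg (c : Bool) {f : Pt d → ℝ} (hf : ∀ x, 0 ≤ f x) (x : Pt (d + 1)) : 0 ≤ orAdj c f x := by
  unfold orAdj; split_ifs; exacts [zero_le_one, hf _]

/-- `f ∨_c x₀ ≤ 1` if `f ≤ 1`. [this work] -/
theorem orAdj_le_one (c : Bool) {f : Pt d → ℝ} (hf : ∀ x, f x ≤ 1) (x : Pt (d + 1)) : orAdj c f x ≤ 1 := by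
  unfold orAdj; split_ifs; exacts [le_rfl, hf _]

/-- `f ∨_c x₀` is monotone if `f` is monotone with `f ≤ 1`. [this work] -/
theorem orAdj_monotone (c : Bool) {f : Pt d → ℝ} (hf : ∀ x, f x ≤ 1) (hfm : Monotone f) : Monotone (orAdj c f) := by
  intro x y hxy
  have ht : Fin.tail x ≤ Fin.tail y := fun i => hxy i.succ
  unfold orAdj
  by_cases hc : c = true
  · by_cases hx : x 0 = true
    · have hy : y 0 = true := Bool.eq_true_of_true_le (hx ▸ hxy 0)
      simp [hc, hx, hy]
    · by_cases hy : y 0 = true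
      · simp [hc, hx, hy, hf]
      · simp [hc, hx, hy, hfm ht]
  · simp [hc, hfm ht]

/-- ★★ **THE OR-LITERAL STEP.**  If `f, g, h : {0,1}^d → [0,1]` are monotone and `0 ≤ c_b(f,g,h)`, then
`0 ≤ c_{(k,b)}(f ∨_{c₁} x₀, g ∨_{c₂} x₀, h ∨_{c₃} x₀)` for every `k` and all bits `c₁, c₂, c₃`. [this work] -/
theorem tc_orAdj_cons_nonneg (k : ℕ) (b : Fin d → ℕ) (c₁ c₂ c₃ : Bool) {f g h : Pt d → ℝ}
    (hf0 : ∀ x, 0 ≤ f x) (hf1 : ∀ x, f x ≤ 1) (hfm : Monotone f) (hg0 : ∀ x, 0 ≤ g x) (hg1 : ∀ x, g x ≤ 1) (hgm : Monotone g)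
    (hh0 : ∀ x, 0 ≤ h x) (hh1 : ∀ x, h x ≤ 1) (hhm : Monotone h) (htc : 0 ≤ tc b f g h) :
    0 ≤ tc (Fin.cons k b : Fin (d + 1) → ℕ) (orAdj c₁ f) (orAdj c₂ g) (orAdj c₃ h) := by
  -- facts about the complement triple (u,v,w) at profile b
  have u0 : ∀ x, 0 ≤ (1 - f) x := fun x => sub_nonneg.2 (hf1 x)
  have v0 : ∀ x, 0 ≤ (1 - g) x := fun x => sub_nonneg.2 (hg1 x)
  have w0 : ∀ x, 0 ≤ (1 - h) x := fun x => sub_nonneg.2 (hh1 x)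
  have u1 : ∀ x, (1 - f) x ≤ 1 := fun x => by simp [hf0 x]
  have v1 : ∀ x, (1 - g) x ≤ 1 := fun x => by simp [hg0 x]
  have w1 : ∀ x, (1 - h) x ≤ 1 := fun x => by simp [hh0 x]
  have one0 : ∀ x : Pt d, (0 : ℝ) ≤ (1 : Pt d → ℝ) x := fun _ => zero_le_one
  have FΦ : 0 ≤ (N3 b ((1 - f) * (1 - g)) 1 1 - N3 b (1 - f) (1 - g) 1) + (N3 b ((1 - f) * (1 - h)) 1 1 - N3 b (1 - f) (1 - h) 1) +
      (N3 b ((1 - g) * (1 - h)) 1 1 - N3 b (1 - g) (1 - h) 1) - (2 * N3 b ((1 - f) * (1 - g) * (1 - h)) 1 1 -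
      (N3 b (1 - f) ((1 - g) * (1 - h)) 1 + N3 b (1 - g) ((1 - f) * (1 - h)) 1 + N3 b (1 - h) ((1 - f) * (1 - g)) 1) +
      N3 b (1 - f) (1 - g) (1 - h)) := by
    have e := tc_compl b (1 - f) (1 - g) (1 - h)
    simp only [sub_sub_cancel] at e
    unfold tc at e htc
    linarith
  have FH1 : 0 ≤ N3 b ((1 - f) * (1 - g)) 1 1 - N3 b (1 - f) (1 - g) 1 := by
    rw [harris_compl]; exact harris3_nonneg b hf0 hfm hg0 hgm one0
  have FH2 : 0 ≤ N3 b ((1 - f) * (1 - h)) 1 1 - N3 b (1 - f) (1 - h) 1 := by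
    rw [harris_compl]; exact harris3_nonneg b hf0 hfm hh0 hhm one0
  have FH3 : 0 ≤ N3 b ((1 - g) * (1 - h)) 1 1 - N3 b (1 - g) (1 - h) 1 := by
    rw [harris_compl]; exact harris3_nonneg b hg0 hgm hh0 hhm one0
  have FU1 : 0 ≤ (N3 b ((1 - f) * (1 - g)) 1 1 - N3 b (1 - f) (1 - g) 1) + (N3 b ((1 - f) * (1 - h)) 1 1 - N3 b (1 - f) (1 - h) 1) -
      N3 b ((1 - f) * (1 - g) * (1 - h)) 1 1 + N3 b (1 - f) ((1 - g) * (1 - h)) 1 := by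
    rw [unionHarris_compl]
    exact harris3_nonneg b hf0 hfm (fun x => mul_nonneg (hg0 x) (hh0 x)) (hgm.mul hhm hg0 hh0) one0
  have FU2 : 0 ≤ (N3 b ((1 - g) * (1 - f)) 1 1 - N3 b (1 - g) (1 - f) 1) + (N3 b ((1 - g) * (1 - h)) 1 1 - N3 b (1 - g) (1 - h) 1) -
      N3 b ((1 - g) * (1 - f) * (1 - h)) 1 1 + N3 b (1 - g) ((1 - f) * (1 - h)) 1 := by
    rw [unionHarris_compl]
    exact harris3_nonneg b hg0 hgm (fun x => mul_nonneg (hf0 x) (hh0 x)) (hfm.mul hhm hf0 hh0) one0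
  have FU3 : 0 ≤ (N3 b ((1 - h) * (1 - f)) 1 1 - N3 b (1 - h) (1 - f) 1) + (N3 b ((1 - h) * (1 - g)) 1 1 - N3 b (1 - h) (1 - g) 1) -
      N3 b ((1 - h) * (1 - f) * (1 - g)) 1 1 + N3 b (1 - h) ((1 - f) * (1 - g)) 1 := by
    rw [unionHarris_compl]
    exact harris3_nonneg b hh0 hhm (fun x => mul_nonneg (hf0 x) (hg0 x)) (hfm.mul hgm hf0 hg0) one0
  -- normalise the symmetric variants to the canonical products
  have c21 : (1 - g) * (1 - f) = (1 - f) * (1 - g) := mul_comm _ _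
  have c31 : (1 - h) * (1 - f) = (1 - f) * (1 - h) := mul_comm _ _
  have c32 : (1 - h) * (1 - g) = (1 - g) * (1 - h) := mul_comm _ _
  have c312 : (1 - f) * (1 - h) * (1 - g) = (1 - f) * (1 - g) * (1 - h) := by ring
  rw [c21, N3_comm12 b (1 - g) (1 - f) 1] at FU2
  rw [c31, c32, c312, N3_comm12 b (1 - h) (1 - f) 1, N3_comm12 b (1 - h) (1 - g) 1] at FU3
  have FM1 : N3 b ((1 - f) * (1 - g) * (1 - h)) 1 1 ≤ N3 b ((1 - f) * (1 - g)) 1 1 :=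
    N3_mono_left b (fun x => by
      simp only [Pi.mul_apply]; exact mul_le_of_le_one_right (mul_nonneg (u0 x) (v0 x)) (w1 x)) one0 one0
  have FM2 : N3 b ((1 - f) * (1 - g) * (1 - h)) 1 1 ≤ N3 b ((1 - f) * (1 - h)) 1 1 :=
    N3_mono_left b (fun x => by
      simp only [Pi.mul_apply]; rw [mul_right_comm]; exact mul_le_of_le_one_right (mul_nonneg (u0 x) (w0 x)) (v1 x)) one0 one0
  have FM3 : N3 b ((1 - f) * (1 - g) * (1 - h)) 1 1 ≤ N3 b ((1 - g) * (1 - h)) 1 1 :=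
    N3_mono_left b (fun x => by
      simp only [Pi.mul_apply]; rw [mul_assoc]; exact mul_le_of_le_one_left (mul_nonneg (v0 x) (w0 x)) (u1 x)) one0 one0
  have FN0 : 0 ≤ N3 b ((1 - f) * (1 - g) * (1 - h)) 1 1 :=
    N3_nonneg b (fun x => mul_nonneg (mul_nonneg (u0 x) (v0 x)) (w0 x)) one0 one0
  have FN3 : 0 ≤ N3 b (1 - f) (1 - g) (1 - h) := N3_nonneg b u0 v0 w0
  -- the level-(d+1) coefficient through complements and the factorisation
  have eF : orAdj c₁ f = 1 - (1 - orAdj c₁ f) := by simp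
  have eG : orAdj c₂ g = 1 - (1 - orAdj c₂ g) := by simp
  have eH : orAdj c₃ h = 1 - (1 - orAdj c₃ h) := by simp
  rw [eF, eG, eH, tc_compl]
  have sU := sec_compl_orAdj c₁ f
  have sV := sec_compl_orAdj c₂ g
  have sW := sec_compl_orAdj c₃ h
  have sUV := sec_mul_form sU sV
  have sUW := sec_mul_form sU sW
  have sVW := sec_mul_form sV sW
  have sUVW := sec_mul_form sUV sW
  have s1 : ∀ ε : Bool, sec (1 : Pt (d + 1) → ℝ) ε = (1 + if ε then nb false else 0) • (1 : Pt d → ℝ) := sec_one_form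
  unfold tc
  rw [N3_cons_form k b sUVW s1 s1, N3_cons_form k b sU sVW s1, N3_cons_form k b sV sUW s1, N3_cons_form k b sW sUV s1,
    N3_cons_form k b sU sV sW, N3_cons_form k b sUV s1 s1, N3_cons_form k b sU sV s1, N3_cons_form k b sUW s1 s1,
    N3_cons_form k b sU sW s1, N3_cons_form k b sVW s1 s1, N3_cons_form k b sV sW s1]
  rcases Nat.lt_or_ge k 4 with hk | hk
  · interval_cases k <;> cases c₁ <;> cases c₂ <;> cases c₃ <;> norm_num [phi, Nat.choose] <;> linarith
  · rw [Nat.choose_eq_zero_of_lt (by omega : 3 < k)]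
    simp


/-! ### §4 Adjoining an AND-literal -/

/-- Up-leaf scalars: `α_c = 1 − c`, `β_c = c` (so `α_c + β_c ε = 1` unless `c ∧ ε = 0`). [this work] -/
def ua (c : Bool) : ℝ := if c then 0 else 1

/-- See `ua`. [this work] -/
def ub (c : Bool) : ℝ := if c then 1 else 0

/-- Products of up-leaf scalars. [this work] -/
theorem ua_form_mul (c₁ c₂ ε : Bool) :
    (ua c₁ + (if ε then ub c₁ else 0)) * (ua c₂ + if ε then ub c₂ else 0) = ua (c₁ || c₂) + if ε then ub (c₁ || c₂) else 0 := by
  cases c₁ <;> cases c₂ <;> cases ε <;> norm_num [ua, ub]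

/-- **The local count for up-leaves**: `L_k = C(3,k)·φ_r(3−k)`, `r` = number of copies requiring the literal `x₀ = 1`. [this work] -/
theorem locN3_upLeaf (k : ℕ) (c₁ c₂ c₃ : Bool) :
    locN3 k (ua c₁) (ub c₁) (ua c₂) (ub c₂) (ua c₃) (ub c₃) = (Nat.choose 3 k : ℝ) * phi (c₁.toNat + c₂.toNat + c₃.toNat) (3 - k) := by
  rcases Nat.lt_or_ge k 4 with hk | hk
  · interval_cases k <;> cases c₁ <;> cases c₂ <;> cases c₃ <;>
      simp only [locN3, Fintype.sum_bool, ua, ub] <;> norm_num [phi, Nat.choose]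
  · rw [locN3_eq_zero_of_four_le hk, Nat.choose_eq_zero_of_lt (by omega : 3 < k)]
    simp

/-- Sections of a product of two functions with up-leaf scalar sections. [this work] -/
theorem sec_mul_upform {U V : Pt (d + 1) → ℝ} {u v : Pt d → ℝ} {c₁ c₂ : Bool}
    (hU : ∀ ε, sec U ε = (ua c₁ + if ε then ub c₁ else 0) • u) (hV : ∀ ε, sec V ε = (ua c₂ + if ε then ub c₂ else 0) • v) :
    ∀ ε, sec (U * V) ε = (ua (c₁ || c₂) + if ε then ub (c₁ || c₂) else 0) • (u * v) := by
  intro ε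
  rw [sec_mul, hU, hV, ← ua_form_mul]
  funext x
  simp only [Pi.mul_apply, Pi.smul_apply, smul_eq_mul]
  ring

/-- The constant `1` has the trivial up-leaf sections (`c = false`). [this work] -/
theorem sec_one_upform : ∀ ε : Bool, sec (1 : Pt (d + 1) → ℝ) ε = (ua false + if ε then ub false else 0) • (1 : Pt d → ℝ) := by
  intro ε; funext x; simp [sec, ua, ub]

/-- ★ `N_{(k,b)}` of three functions with up-leaf sections is `C(3,k)·φ_r(3−k)·N_b(u₁;u₂;u₃)`. [this work] -/
theorem N3_cons_upform (k : ℕ) (b : Fin d → ℕ) {U V W : Pt (d + 1) → ℝ} {u v w : Pt d → ℝ} {c₁ c₂ c₃ : Bool}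
    (hU : ∀ ε, sec U ε = (ua c₁ + if ε then ub c₁ else 0) • u) (hV : ∀ ε, sec V ε = (ua c₂ + if ε then ub c₂ else 0) • v)
    (hW : ∀ ε, sec W ε = (ua c₃ + if ε then ub c₃ else 0) • w) :
    N3 (Fin.cons k b : Fin (d + 1) → ℕ) U V W =
      (Nat.choose 3 k : ℝ) * phi (c₁.toNat + c₂.toNat + c₃.toNat) (3 - k) * N3 b u v w := by
  rw [N3_cons_of_sec k b hU hV hW, locN3_upLeaf]

/-- ADJOIN THE FRESH COORDINATE `0` AS AN AND-LITERAL (if `c`): `(f ∧_c x₀)(x) = 0` if `c` and `x₀ = 0`, else `f(x₁,…,x_d)`. [this work] -/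
def andAdj (c : Bool) (f : Pt d → ℝ) : Pt (d + 1) → ℝ := fun x => if c = true ∧ x 0 = false then 0 else f (Fin.tail x)

/-- Sections of an AND-adjoined function: `(f ∧_c x₀)^ε = (α_c + β_c ε)·f`. [this work] -/
theorem sec_andAdj (c : Bool) (f : Pt d → ℝ) : ∀ ε : Bool, sec (andAdj c f) ε = (ua c + if ε then ub c else 0) • f := by
  intro ε; funext x
  cases c <;> cases ε <;> simp [sec, andAdj, ua, ub, Fin.tail_cons, Fin.cons_zero]

/-- `f ∧_c x₀` is nonnegative. [this work] -/
theorem andAdj_nonneg (c : Bool) {f : Pt d → ℝ} (hf : ∀ x, 0 ≤ f x) (x : Pt (d + 1)) : 0 ≤ andAdj c f x := by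
  unfold andAdj; split_ifs; exacts [le_rfl, hf _]

/-- `f ∧_c x₀ ≤ 1` if `f ≤ 1`. [this work] -/
theorem andAdj_le_one (c : Bool) {f : Pt d → ℝ} (hf : ∀ x, f x ≤ 1) (x : Pt (d + 1)) : andAdj c f x ≤ 1 := by
  unfold andAdj; split_ifs; exacts [zero_le_one, hf _]

/-- `f ∧_c x₀` is monotone if `f ≥ 0` is monotone. [this work] -/
theorem andAdj_monotone (c : Bool) {f : Pt d → ℝ} (hf : ∀ x, 0 ≤ f x) (hfm : Monotone f) : Monotone (andAdj c f) := by
  intro x y hxy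
  have ht : Fin.tail x ≤ Fin.tail y := fun i => hxy i.succ
  unfold andAdj
  by_cases hc : c = true
  · by_cases hy : y 0 = false
    · have hx : x 0 = false := by
        have := hxy 0; rw [hy] at this
        cases hx' : x 0
        · rfl
        · rw [hx'] at this; exact absurd (Bool.le_iff_imp.1 this rfl) (by simp)
      simp [hc, hx, hy]
    · by_cases hx : x 0 = false
      · simp [hc, hx, hy, hf]
      · simp [hc, hx, hy, hfm ht]
  · simp [hc, hfm ht]

/-- ★ **THE AND-LITERAL STEP.**  If `f, g, h ≥ 0` are monotone and `0 ≤ c_b(f,g,h)`, then `0 ≤ c_{(k,b)}(f ∧_{c₁} x₀, g ∧_{c₂} x₀, h ∧_{c₃} x₀)`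
for every `k` and all bits (in each of the 32 cases an explicit nonnegative combination of `c_b(f,g,h)`, `N_b(fgh;1;1)` and the three-copy Harris
gaps `N_b(fgh;1;1) − N_b(f;gh;1)` etc.). [this work] -/
theorem tc_andAdj_cons_nonneg (k : ℕ) (b : Fin d → ℕ) (c₁ c₂ c₃ : Bool) {f g h : Pt d → ℝ}
    (hf0 : ∀ x, 0 ≤ f x) (hfm : Monotone f) (hg0 : ∀ x, 0 ≤ g x) (hgm : Monotone g) (hh0 : ∀ x, 0 ≤ h x) (hhm : Monotone h)
    (htc : 0 ≤ tc b f g h) :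
    0 ≤ tc (Fin.cons k b : Fin (d + 1) → ℕ) (andAdj c₁ f) (andAdj c₂ g) (andAdj c₃ h) := by
  have one0 : ∀ x : Pt d, (0 : ℝ) ≤ (1 : Pt d → ℝ) x := fun _ => zero_le_one
  have FA : N3 b f (g * h) 1 ≤ N3 b (f * g * h) 1 1 := by
    have := N3_le_N3_mul d b f (g * h) 1 hf0 hfm (fun x => mul_nonneg (hg0 x) (hh0 x)) (hgm.mul hhm hg0 hh0) one0
    rwa [← mul_assoc] at this
  have FB : N3 b g (f * h) 1 ≤ N3 b (f * g * h) 1 1 := by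
    have := N3_le_N3_mul d b g (f * h) 1 hg0 hgm (fun x => mul_nonneg (hf0 x) (hh0 x)) (hfm.mul hhm hf0 hh0) one0
    rwa [mul_left_comm, ← mul_assoc] at this
  have FC : N3 b h (f * g) 1 ≤ N3 b (f * g * h) 1 1 := by
    have := N3_le_N3_mul d b h (f * g) 1 hh0 hhm (fun x => mul_nonneg (hf0 x) (hg0 x)) (hfm.mul hgm hf0 hg0) one0
    rwa [mul_comm h (f * g)] at this
  have F0 : 0 ≤ N3 b (f * g * h) 1 1 := N3_nonneg b (fun x => mul_nonneg (mul_nonneg (hf0 x) (hg0 x)) (hh0 x)) one0 one0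
  unfold tc at htc
  have sF := sec_andAdj c₁ f
  have sG := sec_andAdj c₂ g
  have sH := sec_andAdj c₃ h
  have sFG := sec_mul_upform sF sG
  have sFH := sec_mul_upform sF sH
  have sGH := sec_mul_upform sG sH
  have sFGH := sec_mul_upform sFG sH
  have s1 : ∀ ε : Bool, sec (1 : Pt (d + 1) → ℝ) ε = (ua false + if ε then ub false else 0) • (1 : Pt d → ℝ) := sec_one_upform
  unfold tc
  rw [N3_cons_upform k b sFGH s1 s1, N3_cons_upform k b sF sGH s1, N3_cons_upform k b sG sFH s1, N3_cons_upform k b sH sFG s1,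
    N3_cons_upform k b sF sG sH]
  rcases Nat.lt_or_ge k 4 with hk | hk
  · interval_cases k <;> cases c₁ <;> cases c₂ <;> cases c₃ <;> norm_num [phi, Nat.choose] <;> linarith
  · rw [Nat.choose_eq_zero_of_lt (by omega : 3 < k)]
    simp

end

end Summit.CriticalPhenomena.PercolationContinuityZ3.Theorems.SahiThreeCopy
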